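import Literature.Analysis.FunctionSpaces.BesselMomentsDecay
import Mathlib.Analysis.Complex.CauchyIntegral
import Mathlib.MeasureTheory.Measure.Haar.NormedSpace
import Mathlib.MeasureTheory.Integral.Prod
import Mathlib.MeasureTheory.Measure.Lebesgue.Integral
import Mathlib.MeasureTheory.Integral.DominatedConvergence
import HarnessLib

/-!
# Proof of Zhou's B³G sum rule `Z_{2n,n-2k} = 0` (`n ≥ 2k ≥ 2`): `Zhou2017_B3G_sumRule_holds`

Theorem-only sibling of `BesselMoments.lean` / `BesselMomentsKernel.lean` (last file of the
chain), discharging the named fact `Zhou2017_B3G_sumRule` (Y. Zhou, *Hilbert transforms and sum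
rules of Bessel moments*, Ramanujan J. 48 (2019), arXiv:1706.01068, **Theorem 3.3**).

* **Cauchy–Goursat** on `[-R, R] × [δ, T]` for `G_{n,j} = [K₀(z)K₀(-z)]ⁿ zʲ`
  (`Complex.integral_boundary_rect_eq_zero_of_differentiableOn`); the vertical sides are
  `O((T-δ)/R²)`, the top side is `O(1/T)` (`∫_ℝ (x² + T²)⁻¹ = π/T`), so `∫_ℝ G(x + iδ) dx = 0` for
  every `δ > 0`; dominated convergence (`δ → 0⁺`, pointwise limit from the vertical continuity of
  `P`) gives **`∫_ℝ G_{n,j}(x) dx = 0` for `j + 2 ≤ n`** (`integral_zhouG_real_eq_zero`) — this is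
  Zhou's `∫_ℝ ζ_n(x) xʲ dx = 0, j ∈ [0, n-1)` (proof of Thm. 3.3 / Prop. 3.2).
* **Folding** `ℝ → (0,∞)`: `G(t) + G(-t) = K₀ⁿtʲ[(K₀ + iπI₀)ⁿ + (-1)ʲ(K₀ - iπI₀)ⁿ]`, and for
  `j = n - 2k` the bracket is `(a+b)ⁿ + (a-b)ⁿ = 2Σ_m C(n,2m)a^{n-2m}b^{2m}` with `a = iπI₀`,
  `b = K₀`, i.e. `2iⁿ Σ_m (-1)ᵐ C(n,2m)(πI₀)^{n-2m}K₀^{n+2m}tʲ` — Zhou's binomial expansion of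
  `ζ_n` ("Simply notice that binomial expansion leads us to `ζ_n = Σ (-1)ᵐ C(n,2m)(ι sgn)^{n-2m}
  κ^{n+2m}`", proof of Thm. 3.3). Each moment `∫₀^∞ (πI₀)^{n-2m}K₀^{n+2m}tʲ` converges absolutely
  (`|·| ≤ ‖G_{n,j}‖` pointwise), so the finite sum commutes with the integral and
  `2iⁿ · zhouZ n (n-2k) = ∫_ℝ G = 0`.

## References

* [Zhou2017] Y. Zhou, Hilbert transforms and sum rules of Bessel moments, Ramanujan J. 48 (2019)
  159–172, arXiv:1706.01068 — Prop. 3.2, Thm. 3.3 and its proof (p. 5 of the arXiv version).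
-/

noncomputable section

open MeasureTheory Set Filter
open scoped Topology ComplexConjugate

namespace Literature.Analysis.FunctionSpaces

/-! ### Cauchy's theorem on rectangles in the upper half-plane and the three limits -/

/-- **Cauchy–Goursat on `[-R, R] × [δ, T]`** (`0 < δ ≤ T`), where `G_{n,j}` is holomorphic. [folklore] -/
theorem zhouG_rect (n j : ℕ) {δ T : ℝ} (hδ : 0 < δ) (hδT : δ ≤ T) (R : ℝ) :
    (∫ x : ℝ in -R..R, zhouG n j (x + δ * Complex.I)) -
        (∫ x : ℝ in -R..R, zhouG n j (x + T * Complex.I)) +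
      Complex.I • (∫ y : ℝ in δ..T, zhouG n j (R + y * Complex.I)) -
      Complex.I • (∫ y : ℝ in δ..T, zhouG n j (-R + y * Complex.I)) = 0 := by
  have h := Complex.integral_boundary_rect_eq_zero_of_differentiableOn (zhouG n j)
    (-R + δ * Complex.I) (R + T * Complex.I) ?_
  · simpa using h
  · intro z hz
    apply (differentiableAt_zhouG n j ?_).differentiableWithinAt
    have h2 : z.im ∈ uIcc ((-R + δ * Complex.I).im) ((R + T * Complex.I).im) := hz.2
    simp only [Complex.add_im, Complex.neg_im, Complex.ofReal_im, neg_zero, Complex.mul_im,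
      Complex.ofReal_re, Complex.I_im, mul_one, Complex.I_re, mul_zero, add_zero, zero_add,
      uIcc_of_le hδT] at h2
    exact (hδ.trans_le h2.1).ne'

/-- On the vertical sides `|Re z| ≥ 1`: `‖G_{n,j} z‖ ≤ C₁^{2n} / (Re z)²`. [folklore] -/
theorem norm_zhouG_le_of_re {n j : ℕ} (hn : j + 2 ≤ n) {z : ℂ} (hz : 1 ≤ |z.re|) :
    ‖zhouG n j z‖ ≤ (Real.sqrt 3 * Real.sqrt Real.pi + 4) ^ (2 * n) / z.re ^ 2 := by
  have h1 : |z.re| ≤ ‖z‖ := Complex.abs_re_le_norm z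
  have h2 : 1 ≤ ‖z‖ := hz.trans h1
  refine (norm_zhouG_le_large hn h2).trans ?_
  rw [← sq_abs z.re]
  gcongr

/-- **The vertical sides vanish as `R → ∞`.** [folklore] -/
theorem tendsto_zhouG_vertical_side {n j : ℕ} (hn : j + 2 ≤ n) (δ T : ℝ) {s : ℝ} (hs : |s| = 1) :
    Tendsto (fun R : ℝ => ∫ y : ℝ in δ..T, zhouG n j ((s * R : ℝ) + y * Complex.I)) atTop (𝓝 0) := by
  set C : ℝ := (Real.sqrt 3 * Real.sqrt Real.pi + 4) ^ (2 * n) with hC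
  have hg : Tendsto (fun R : ℝ => C / R ^ 2 * |T - δ|) atTop (𝓝 0) := by
    have h1 : Tendsto (fun R : ℝ => (R ^ 2)⁻¹) atTop (𝓝 0) :=
      (tendsto_pow_atTop two_ne_zero).inv_tendsto_atTop
    have h2 := (h1.const_mul C).mul_const |T - δ|
    simpa [div_eq_mul_inv] using h2
  refine squeeze_zero_norm' ?_ hg
  filter_upwards [eventually_ge_atTop (1 : ℝ)] with R hR
  refine intervalIntegral.norm_integral_le_of_norm_le_const fun y _ => ?_
  have hre : ((s * R : ℝ) + y * Complex.I : ℂ).re = s * R := by simp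
  have h1 : 1 ≤ |((s * R : ℝ) + y * Complex.I : ℂ).re| := by
    rw [hre, abs_mul, hs, one_mul, abs_of_pos (one_pos.trans_le hR)]
    exact hR
  refine (norm_zhouG_le_of_re hn h1).trans (le_of_eq ?_)
  rw [hre, mul_pow, ← sq_abs s, hs, ← hC]
  ring

/-- **Independence of the height**: `∫_ℝ G(x + iδ) dx = ∫_ℝ G(x + iT) dx` for `0 < δ ≤ T`. [folklore] -/
theorem integral_zhouG_line_eq {n j : ℕ} (hn : j + 2 ≤ n) {δ T : ℝ} (hδ : 0 < δ) (hδT : δ ≤ T) :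
    ∫ x : ℝ, zhouG n j (x + δ * Complex.I) = ∫ x : ℝ, zhouG n j (x + T * Complex.I) := by
  have hT : 0 < T := hδ.trans_le hδT
  have hbot : Tendsto (fun R : ℝ => ∫ x : ℝ in -R..R, zhouG n j (x + δ * Complex.I)) atTop
      (𝓝 (∫ x : ℝ, zhouG n j (x + δ * Complex.I))) :=
    intervalIntegral_tendsto_integral (integrable_zhouG_line hn hδ) tendsto_neg_atTop_atBot
      tendsto_id
  have htop : Tendsto (fun R : ℝ => ∫ x : ℝ in -R..R, zhouG n j (x + T * Complex.I)) atTop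
      (𝓝 (∫ x : ℝ, zhouG n j (x + T * Complex.I))) :=
    intervalIntegral_tendsto_integral (integrable_zhouG_line hn hT) tendsto_neg_atTop_atBot
      tendsto_id
  have hv1 := tendsto_zhouG_vertical_side hn δ T (s := 1) (by simp)
  have hv2 := tendsto_zhouG_vertical_side hn δ T (s := -1) (by simp)
  simp only [one_mul, neg_mul, Complex.ofReal_neg] at hv1 hv2
  have hlim := ((hbot.sub htop).add (hv1.const_smul Complex.I)).sub (hv2.const_smul Complex.I)
  have hzero : (fun R : ℝ => (∫ x : ℝ in -R..R, zhouG n j (x + δ * Complex.I)) -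
        (∫ x : ℝ in -R..R, zhouG n j (x + T * Complex.I)) +
      Complex.I • (∫ y : ℝ in δ..T, zhouG n j (R + y * Complex.I)) -
      Complex.I • (∫ y : ℝ in δ..T, zhouG n j (-R + y * Complex.I))) = fun _ => 0 :=
    funext fun R => zhouG_rect n j hδ hδT R
  rw [hzero] at hlim
  have h := tendsto_nhds_unique hlim tendsto_const_nhds
  simp only [smul_zero, add_zero, sub_zero] at h
  exact sub_eq_zero.1 h

/-- `∫_ℝ (x² + T²)⁻¹ dx = π / T` (`T > 0`). [folklore] -/
theorem integral_inv_sq_add_sq {T : ℝ} (hT : 0 < T) :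
    ∫ x : ℝ, (x ^ 2 + T ^ 2)⁻¹ = Real.pi / T := by
  have h : (fun x : ℝ => (x ^ 2 + T ^ 2)⁻¹) = fun x => (T ^ 2)⁻¹ * (1 + (x / T) ^ 2)⁻¹ := by
    funext x
    have hT2 : T ^ 2 ≠ 0 := pow_ne_zero 2 hT.ne'
    rw [← mul_inv]
    congr 1
    field_simp
    ring
  rw [h, integral_const_mul, Measure.integral_comp_div (fun y : ℝ => (1 + y ^ 2)⁻¹) T,
    integral_univ_inv_one_add_sq, abs_of_pos hT, smul_eq_mul]
  field_simp

/-- `x ↦ (x² + T²)⁻¹` is integrable (`T ≠ 0`). [folklore] -/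
theorem integrable_inv_sq_add_sq {T : ℝ} (hT : T ≠ 0) :
    Integrable fun x : ℝ => (x ^ 2 + T ^ 2)⁻¹ := by
  have h : (fun x : ℝ => (x ^ 2 + T ^ 2)⁻¹) = fun x => (T ^ 2)⁻¹ * (1 + (x / T) ^ 2)⁻¹ := by
    funext x
    have hT2 : T ^ 2 ≠ 0 := pow_ne_zero 2 hT
    rw [← mul_inv]
    congr 1
    field_simp
    ring
  rw [h]
  exact (integrable_inv_one_add_sq.comp_div hT).const_mul _

/-- **The top side vanishes**: `∫_ℝ G(x + iT) dx → 0` as `T → ∞`. [folklore] -/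
theorem tendsto_integral_zhouG_top {n j : ℕ} (hn : j + 2 ≤ n) :
    Tendsto (fun T : ℝ => ∫ x : ℝ, zhouG n j (x + T * Complex.I)) atTop (𝓝 0) := by
  set C : ℝ := (Real.sqrt 3 * Real.sqrt Real.pi + 4) ^ (2 * n) with hC
  have hg : Tendsto (fun T : ℝ => C * (Real.pi / T)) atTop (𝓝 0) := by
    have h := (tendsto_const_nhds (x := Real.pi)).div_atTop tendsto_id
    simpa using h.const_mul C
  refine squeeze_zero_norm' ?_ hg
  filter_upwards [eventually_ge_atTop (1 : ℝ)] with T hT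
  have hT0 : 0 < T := one_pos.trans_le hT
  have hbound : ∀ x : ℝ, ‖zhouG n j (x + T * Complex.I)‖ ≤ C * (x ^ 2 + T ^ 2)⁻¹ := by
    intro x
    have hz2 : ‖(x : ℂ) + T * Complex.I‖ ^ 2 = x ^ 2 + T ^ 2 := norm_sq_ofReal_add_mul_I x T
    have hzT : T ≤ ‖(x : ℂ) + T * Complex.I‖ := by
      have := Complex.abs_im_le_norm ((x : ℂ) + T * Complex.I)
      simpa [abs_of_pos hT0] using this
    have h1 := norm_zhouG_le_large hn (hT.trans hzT)
    rwa [hz2, div_eq_mul_inv] at h1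
  calc ‖∫ x : ℝ, zhouG n j (x + T * Complex.I)‖
      ≤ ∫ x : ℝ, C * (x ^ 2 + T ^ 2)⁻¹ :=
        norm_integral_le_of_norm_le ((integrable_inv_sq_add_sq hT0.ne').const_mul C)
          (Eventually.of_forall hbound)
    _ = C * (Real.pi / T) := by rw [integral_const_mul, integral_inv_sq_add_sq hT0]

/-- **All heights give `0`**: `∫_ℝ G(x + iδ) dx = 0` for every `δ > 0`. [folklore] -/
theorem integral_zhouG_line_eq_zero {n j : ℕ} (hn : j + 2 ≤ n) {δ : ℝ} (hδ : 0 < δ) :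
    ∫ x : ℝ, zhouG n j (x + δ * Complex.I) = 0 := by
  have h1 : ∀ᶠ T : ℝ in atTop, (∫ x : ℝ, zhouG n j (x + T * Complex.I)) =
      ∫ x : ℝ, zhouG n j (x + δ * Complex.I) := by
    filter_upwards [eventually_ge_atTop δ] with T hT
    exact (integral_zhouG_line_eq hn hδ hT).symm
  have h2 := (tendsto_integral_zhouG_top hn).congr' h1
  exact tendsto_nhds_unique tendsto_const_nhds h2

/-- **Pointwise boundary limit**: `G(x + iδ) → G(x)` as `δ → 0⁺` (`x ≠ 0` real). [folklore] -/
theorem tendsto_zhouG_vertical (n j : ℕ) {x : ℝ} (hx : x ≠ 0) :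
    Tendsto (fun δ : ℝ => zhouG n j (x + δ * Complex.I)) (𝓝[>] 0) (𝓝 (zhouG n j x)) := by
  have hP : ∀ {y : ℝ}, y ≠ 0 →
      Tendsto (fun δ : ℝ => zhouP (y + δ * Complex.I)) (𝓝[>] 0) (𝓝 (zhouP y)) := by
    intro y hy
    have h := (continuousWithinAt_zhouP_vertical hy).tendsto
    simp only [Complex.ofReal_zero, zero_mul, add_zero] at h
    exact h.mono_left (nhdsWithin_mono _ Ioi_subset_Ici_self)
  have hconj : ∀ δ : ℝ, -conj ((x : ℂ) + δ * Complex.I) = ((-x : ℝ) : ℂ) + δ * Complex.I := by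
    intro δ
    apply Complex.ext <;> simp
  have hx0 : -conj (x : ℂ) = ((-x : ℝ) : ℂ) := by
    apply Complex.ext <;> simp
  have hF : Tendsto (fun δ : ℝ => zhouF (x + δ * Complex.I)) (𝓝[>] 0) (𝓝 (zhouF x)) := by
    simp only [zhouF, hconj, hx0]
    exact (hP hx).mul ((Complex.continuous_conj.tendsto _).comp (hP (neg_ne_zero.2 hx)))
  simp only [zhouG]
  refine (hF.pow n).mul ?_
  have hc : Continuous (fun δ : ℝ => ((x : ℂ) + δ * Complex.I)) := by fun_prop
  have h := hc.tendsto 0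
  simp only [Complex.ofReal_zero, zero_mul, add_zero] at h
  exact (h.mono_left nhdsWithin_le_nhds).pow j

/-- **The moment integrals over `ℝ` vanish**: `∫_ℝ G_{n,j}(x) dx = 0` for `j + 2 ≤ n`, where on the
real axis `G_{n,j}(x) = F(x)ⁿ xʲ` is the boundary value (dominated convergence as `δ → 0⁺`).
[folklore] -/
theorem integral_zhouG_real_eq_zero {n j : ℕ} (hn : j + 2 ≤ n) :
    ∫ x : ℝ, zhouG n j x = 0 := by
  have hlim : Tendsto (fun δ : ℝ => ∫ x : ℝ, zhouG n j (x + δ * Complex.I)) (𝓝[>] 0)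
      (𝓝 (∫ x : ℝ, zhouG n j x)) := by
    refine tendsto_integral_filter_of_dominated_convergence _ ?_ ?_ (integrable_zhouG_dominator n) ?_
    · filter_upwards [self_mem_nhdsWithin] with δ hδ
      exact (continuous_zhouG_line n j (ne_of_gt hδ)).aestronglyMeasurable
    · refine Eventually.of_forall fun δ => ?_
      filter_upwards [Measure.ae_ne volume (0 : ℝ)] with x hx
      exact norm_zhouG_line_le_unif hn δ hx
    · filter_upwards [Measure.ae_ne volume (0 : ℝ)] with x hx
      exact tendsto_zhouG_vertical n j hx
  have hconst : (fun δ : ℝ => ∫ x : ℝ, zhouG n j (x + δ * Complex.I)) =ᶠ[𝓝[>] 0] fun _ => 0 := by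
    filter_upwards [self_mem_nhdsWithin] with δ hδ
    exact integral_zhouG_line_eq_zero hn hδ
  exact tendsto_nhds_unique (hlim.congr' hconst) tendsto_const_nhds

/-! ### Assembly: from `∫_ℝ G = 0` to `Z_{2n,n-2k} = 0` -/

/-- **Each Bessel moment in `Z_{2n,j}` is dominated by `‖G_{n,j}‖`**:
`|(πI₀)^{n-2m} K₀^{n+2m} tʲ| ≤ ‖G_{n,j}(t)‖` (`t > 0`, `2m ≤ n`), because `πI₀K₀ = Im F ≤ |F|` and
`K₀² = Re F ≤ |F|`. [folklore] -/
theorem abs_besselMoment_integrand_le {n j m : ℕ} (hm : 2 * m ≤ n) {t : ℝ} (ht : 0 < t) :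
    |(Real.pi * besselI 0 t) ^ (n - 2 * m) * besselKReal 0 t ^ (n + 2 * m) * t ^ j| ≤
      ‖zhouG n j t‖ := by
  set K : ℝ := besselKReal 0 t with hKdef
  set J : ℝ := Real.pi * besselI 0 t with hJdef
  have hK : 0 < K := besselKReal_pos 0 ht
  have hJ : 0 < J := mul_pos Real.pi_pos (besselI_zero_pos t)
  have hnF : ‖zhouF t‖ = K * ‖(K : ℂ) + J * Complex.I‖ := by
    rw [zhouF_ofReal_pos ht, norm_mul, Complex.norm_real, Real.norm_of_nonneg hK.le]
  have h1 : K * J ≤ ‖zhouF t‖ := by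
    rw [hnF]
    refine mul_le_mul_of_nonneg_left ?_ hK.le
    have := Complex.abs_im_le_norm ((K : ℂ) + J * Complex.I)
    simpa [abs_of_pos hJ] using this
  have h2 : K * K ≤ ‖zhouF t‖ := by
    rw [hnF]
    refine mul_le_mul_of_nonneg_left ?_ hK.le
    have := Complex.abs_re_le_norm ((K : ℂ) + J * Complex.I)
    simpa [abs_of_pos hK] using this
  rw [abs_of_pos (by positivity), norm_zhouG_eq, Complex.norm_real, Real.norm_of_nonneg ht.le]
  refine mul_le_mul_of_nonneg_right ?_ (by positivity)
  have e : J ^ (n - 2 * m) * K ^ (n + 2 * m) = (K * J) ^ (n - 2 * m) * (K * K) ^ (2 * m) := by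
    have : n + 2 * m = (n - 2 * m) + 2 * m + 2 * m := by omega
    rw [this, pow_add, pow_add, mul_pow, mul_pow]
    ring
  rw [e]
  calc (K * J) ^ (n - 2 * m) * (K * K) ^ (2 * m)
      ≤ ‖zhouF t‖ ^ (n - 2 * m) * ‖zhouF t‖ ^ (2 * m) := by gcongr
    _ = ‖zhouF t‖ ^ n := by rw [← pow_add, Nat.sub_add_cancel hm]

/-- The Bessel moments occurring in `Z_{2n,j}` converge absolutely (`j + 2 ≤ n`, `2m ≤ n`). [folklore] -/
theorem integrableOn_besselMoment_integrand {n j m : ℕ} (hn : j + 2 ≤ n) (hm : 2 * m ≤ n) :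
    IntegrableOn (fun t : ℝ => (Real.pi * besselI 0 t) ^ (n - 2 * m) * besselKReal 0 t ^ (n + 2 * m) * t ^ j)
      (Ioi 0) := by
  have hG : IntegrableOn (fun t : ℝ => zhouG n j t) (Ioi 0) := (integrable_zhouG_real hn).integrableOn
  refine Integrable.mono' hG.norm ?_ ?_
  · apply Measurable.aestronglyMeasurable
    have h1 := (continuous_besselI 0).measurable
    have h2 := measurable_besselKReal 0
    exact (((measurable_const.mul h1).pow_const _).mul (h2.pow_const _)).mul (measurable_id.pow_const _)
  · refine ae_restrict_of_forall_mem measurableSet_Ioi fun t ht => ?_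
    rw [Real.norm_eq_abs]
    exact abs_besselMoment_integrand_le hm ht

/-- `(a + b)ⁿ + (a - b)ⁿ = 2 Σ_{m ≤ n/2} C(n,2m) a^{n-2m} b^{2m}`. [folklore] -/
theorem add_pow_add_sub_pow (a b : ℂ) (n : ℕ) :
    (a + b) ^ n + (a - b) ^ n =
      2 * ∑ m ∈ Finset.range (n / 2 + 1), (n.choose (2 * m) : ℂ) * a ^ (n - 2 * m) * b ^ (2 * m) := by
  have h1 : (a + b) ^ n = ∑ r ∈ Finset.range (n + 1), b ^ r * a ^ (n - r) * (n.choose r : ℂ) := by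
    rw [add_comm, add_pow]
  have h2 : (a - b) ^ n = ∑ r ∈ Finset.range (n + 1), (-b) ^ r * a ^ (n - r) * (n.choose r : ℂ) := by
    rw [sub_eq_add_neg, add_comm, add_pow]
  rw [h1, h2, ← Finset.sum_add_distrib]
  have himg : (Finset.range (n + 1)).filter Even = (Finset.range (n / 2 + 1)).image (fun m => 2 * m) := by
    ext r
    simp only [Finset.mem_filter, Finset.mem_range, Finset.mem_image]
    constructor
    · rintro ⟨hr, ⟨m, hm⟩⟩
      exact ⟨m, by omega, by omega⟩
    · rintro ⟨m, hm, rfl⟩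
      exact ⟨by omega, ⟨m, by ring⟩⟩
  have h3 : ∑ m ∈ Finset.range (n / 2 + 1), (n.choose (2 * m) : ℂ) * a ^ (n - 2 * m) * b ^ (2 * m) =
      ∑ r ∈ (Finset.range (n + 1)).filter Even, (n.choose r : ℂ) * a ^ (n - r) * b ^ r := by
    rw [himg, Finset.sum_image]
    intro x _ y _ h
    simp only at h
    omega
  rw [h3, Finset.sum_filter, Finset.mul_sum]
  refine Finset.sum_congr rfl fun r _ => ?_
  rcases Nat.even_or_odd r with he | ho
  · rw [if_pos he, he.neg_pow]
    ring
  · rw [if_neg (Nat.not_even_iff_odd.2 ho), ho.neg_pow]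
    ring

/-- `i^{n-2m} = iⁿ (-1)ᵐ` for `2m ≤ n`. [folklore] -/
theorem I_pow_sub_two_mul {n m : ℕ} (hm : 2 * m ≤ n) :
    Complex.I ^ (n - 2 * m) = Complex.I ^ n * (-1) ^ m := by
  have h0 : Complex.I ^ (n - 2 * m) * (-1) ^ m = Complex.I ^ n := by
    rw [← Complex.I_sq, ← pow_mul, ← pow_add, Nat.sub_add_cancel hm]
  calc Complex.I ^ (n - 2 * m) = Complex.I ^ (n - 2 * m) * ((-1) ^ m * (-1) ^ m) := by
        rw [← pow_add, ← two_mul, pow_mul, neg_one_sq, one_pow, mul_one]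
    _ = Complex.I ^ n * (-1) ^ m := by rw [← mul_assoc, h0]

/-- **The boundary combination is Zhou's `ζ_n`:** for `t > 0` and `j + 2k = n`,
`G_{n,j}(t) + G_{n,j}(-t) = 2iⁿ Σ_m (-1)ᵐ C(n,2m) (πI₀)^{n-2m} K₀^{n+2m} tʲ`. [folklore] -/
theorem zhouG_add_zhouG_neg {n j k : ℕ} (hjk : j + 2 * k = n) {t : ℝ} (ht : 0 < t) :
    zhouG n j t + zhouG n j (-(t : ℂ)) =
      2 * Complex.I ^ n * ∑ m ∈ Finset.range (n / 2 + 1), (-1 : ℂ) ^ m * (n.choose (2 * m) : ℂ) *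
        (((Real.pi * besselI 0 t) ^ (n - 2 * m) * besselKReal 0 t ^ (n + 2 * m) * t ^ j : ℝ) : ℂ) := by
  set K : ℝ := besselKReal 0 t with hKdef
  set J : ℝ := Real.pi * besselI 0 t with hJdef
  simp only [zhouG, zhouF_ofReal_pos ht, zhouF_neg_ofReal_pos ht]
  have hsign : (-(t : ℂ)) ^ j = (-1) ^ n * (t : ℂ) ^ j := by
    rw [neg_pow, ← hjk, pow_add, pow_mul, neg_one_sq, one_pow, mul_one]
  rw [hsign]
  have key := add_pow_add_sub_pow ((J : ℂ) * Complex.I) K n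
  have e1 : ((K : ℂ) * ((K : ℂ) + (J : ℂ) * Complex.I)) ^ n * (t : ℂ) ^ j +
      ((K : ℂ) * ((K : ℂ) - (J : ℂ) * Complex.I)) ^ n * ((-1) ^ n * (t : ℂ) ^ j) =
      (K : ℂ) ^ n * (t : ℂ) ^ j * (((J : ℂ) * Complex.I + K) ^ n + ((J : ℂ) * Complex.I - K) ^ n) := by
    have : ((J : ℂ) * Complex.I - K) ^ n = (-1) ^ n * ((K : ℂ) - (J : ℂ) * Complex.I) ^ n := by
      rw [← neg_sub, neg_pow]
    rw [this, mul_pow, mul_pow, add_comm ((J : ℂ) * Complex.I) (K : ℂ)]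
    ring
  rw [e1, key]
  simp only [Finset.mul_sum]
  refine Finset.sum_congr rfl fun m hm => ?_
  have hm' : 2 * m ≤ n := by
    have := Finset.mem_range.1 hm
    omega
  rw [mul_pow (J : ℂ) Complex.I, I_pow_sub_two_mul hm']
  push_cast
  ring

/-- `Z_{2n,j}` as a complex number: `2iⁿ · Z_{2n,j} = ∫₀^∞ (G_{n,j}(t) + G_{n,j}(-t)) dt` (`j + 2k = n`,
`k ≥ 1`). [folklore] -/
theorem integral_zhouG_add_zhouG_neg {n j k : ℕ} (hjk : j + 2 * k = n) (hk : 1 ≤ k) :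
    ∫ t in Ioi (0 : ℝ), (zhouG n j t + zhouG n j (-(t : ℂ))) = 2 * Complex.I ^ n * (zhouZ n j : ℂ) := by
  have hn : j + 2 ≤ n := by omega
  rw [setIntegral_congr_fun measurableSet_Ioi (fun t ht => zhouG_add_zhouG_neg hjk ht), integral_const_mul,
    integral_finsetSum]
  · congr 1
    rw [zhouZ, Complex.ofReal_sum]
    refine Finset.sum_congr rfl fun m _ => ?_
    rw [integral_const_mul, integral_complex_ofReal]
    simp only [Complex.ofReal_mul, Complex.ofReal_pow, Complex.ofReal_neg, Complex.ofReal_one,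
      Complex.ofReal_natCast]
  · intro m hm
    have hm' : 2 * m ≤ n := by
      have := Finset.mem_range.1 hm
      omega
    refine Integrable.const_mul ?_ _
    exact (integrableOn_besselMoment_integrand hn hm').ofReal

/-- **Zhou 2017, Theorem 3.3 (the Bailey–Borwein–Broadhurst–Glasser sum rule), proved**:
`Z_{2n,n-2k} = 0` for all `n ≥ 2k ≥ 2`. The printed proof runs through Hilbert-transform "ladders";
here the same analytic input — that `κ(κ + iι sgn)` is the boundary value of the function
`K₀(z)K₀(-z)`, holomorphic in the upper half-plane with `O(|z|⁻¹)` decay — is used directly: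
`∫_ℝ [K₀K₀(-·)]ⁿ(x + i0) xʲ dx = 0` for `j ≤ n - 2` by Cauchy's theorem, and the even/odd parts of
this identity are `2iⁿ Z_{2n,j}`. [cite: Zhou2017, Thm. 3.3] -/
theorem Zhou2017_B3G_sumRule_holds : Zhou2017_B3G_sumRule := by
  intro n k hk hkn
  set j := n - 2 * k with hj
  have hjk : j + 2 * k = n := Nat.sub_add_cancel hkn
  have hn : j + 2 ≤ n := by omega
  have hint : Integrable (fun x : ℝ => zhouG n j x) := integrable_zhouG_real hn
  have h0 := integral_zhouG_real_eq_zero hn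
  have hsplit : ∫ x : ℝ, zhouG n j x = ∫ x in Ioi (0 : ℝ), (zhouG n j x + zhouG n j (-(x : ℂ))) := by
    rw [← intervalIntegral.integral_Iic_add_Ioi (b := 0) hint.integrableOn hint.integrableOn]
    have h1 : ∫ x in Iic (0 : ℝ), zhouG n j x = ∫ x in Ioi (0 : ℝ), zhouG n j (-(x : ℂ)) := by
      have := integral_comp_neg_Ioi 0 (fun x : ℝ => zhouG n j x)
      simp only [neg_zero, Complex.ofReal_neg] at this
      exact this.symm
    rw [h1, ← integral_add (hint.comp_neg.integrableOn.congr ?_) hint.integrableOn]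
    · exact setIntegral_congr_fun measurableSet_Ioi fun x _ => by ring
    · exact Eventually.of_forall fun x => by simp
  rw [hsplit, integral_zhouG_add_zhouG_neg hjk hk] at h0
  have hI : (2 : ℂ) * Complex.I ^ n ≠ 0 := mul_ne_zero two_ne_zero (pow_ne_zero _ Complex.I_ne_zero)
  have h1 : (zhouZ n j : ℂ) = 0 := by
    rcases mul_eq_zero.1 h0 with h | h
    · exact (hI h).elim
    · exact h
  exact_mod_cast h1

end Literature.Analysis.FunctionSpaces
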